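import Mathlib.Analysis.Calculus.Taylor
import Mathlib.Analysis.Calculus.IteratedDeriv.Lemmas
import Mathlib.LinearAlgebra.Vandermonde
import Mathlib.LinearAlgebra.Matrix.NonsingularInverse
import HarnessLib

/-!
# Route ClusterCompleteness — crux `OmegaLimitMultiKerr`, line `registered` (birth): `stub_landau`

Helper file for the crux `stmt-FinalStateConjecture-17639`
(`Summit.FinalStateConjecture.FinalStateConjecture.Theses.ClusterCompleteness.OmegaLimitMultiKerr`),
closing the stub `stub_landau` of the registered birth skeleton
(`Cruxes/OmegaLimitMultiKerr/Lines/birth.lean`): the one-variable, crude ENDPOINT form of the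
Landau–Kolmogorov interpolation inequality, vector-valued. For every `n ≥ 2` there is
`C = C(n) > 0` such that for every real normed space `W`, every `T > 0` and every `φ : ℝ → W`
that is `Cⁿ` at each point of `[0, T]`, with `‖φ‖ ≤ A` and `‖φ⁽ⁿ⁾‖ ≤ B` on `[0, T]`,
`‖φ'(0)‖ ≤ C (A / T + B Tⁿ⁻¹)`.

Proof (Taylor's formula at equidistant nodes + the inverse Vandermonde matrix, vector-valued
throughout, no scalarisation). Write `n = m + 2`. Let `p` be the Taylor polynomial of `φ` of
order `m + 1` at `0` within `[0, T]`; by `taylor_mean_remainder_bound`,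
`‖φ(t) − p(t)‖ ≤ B tⁿ / (m + 1)! ≤ B Tⁿ` on `[0, T]`, so `‖p(tᵢ)‖ ≤ A + B Tⁿ` at the `n` nodes
`tᵢ = T · i / (m + 1)`, `i = 0, …, m + 1`. With the rescaled Taylor coefficients
`c_j = (T ^ j / j!) • φ^{(j)}(0) ∈ W` one has `p(tᵢ) = Σ_j V i j • c_j`, `V` the Vandermonde matrix
of the distinct reals `i / (m + 1)` (`Matrix.det_vandermonde_ne_zero_iff`), hence
`c_1 = Σ_i (V⁻¹) 1 i • p(tᵢ)` and `T ‖φ'(0)‖ = ‖c_1‖ ≤ K (A + B Tⁿ)` with `K = Σ_i |(V⁻¹) 1 i|`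
depending on `n` only; `C = K + 1` works.

Sources: E. Landau, *Einige Ungleichungen für zweimal differentiierbare Funktionen*, Proc. LMS
(2) 13 (1913) (`n = 2`); A. N. Kolmogorov, Uchen. Zap. MGU 30 (1939) (sharp constants on `ℝ`,
not needed). Deliberately NOT here: sharp constants, interior points, intermediate derivatives
`φ^{(k)}`, `1 ≤ k < n` (the neighbouring stub `stub_coneInterp` only consumes this endpoint,
first-derivative form). [folklore]
-/

noncomputable section

-- D-0017: single-problem summit, Summit.<S>.<S>.… by design
set_option linter.dupNamespace false

open scoped ContDiff Topology
open Set Filter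

namespace Summit.FinalStateConjecture.FinalStateConjecture.Theorems.ClusterCompleteness

/-- Vandermonde-type inversion with vector coefficients: if `V` is a real square matrix with
`IsUnit V.det` and `c : Fin N → W` are vectors of a real vector space, then the `i₀`-th coefficient
is recovered from the values `Σ_j V i j • c j` by the `i₀`-th row of `V⁻¹`:
`Σ_i (V⁻¹) i₀ i • Σ_j V i j • c j = c i₀` (plain `V⁻¹ * V = 1`, `Matrix.nonsing_inv_mul`).
[folklore] -/
theorem landau_sum_inv_smul_sum_smul_eq {N : ℕ} {W : Type*} [AddCommGroup W] [Module ℝ W]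
    (V : Matrix (Fin N) (Fin N) ℝ) (hV : IsUnit V.det) (c : Fin N → W) (i₀ : Fin N) :
    ∑ i, V⁻¹ i₀ i • ∑ j, V i j • c j = c i₀ := by
  calc ∑ i, V⁻¹ i₀ i • ∑ j, V i j • c j = ∑ j, (V⁻¹ * V) i₀ j • c j := by
        simp_rw [Finset.smul_sum, smul_smul, Matrix.mul_apply, Finset.sum_smul]
        exact Finset.sum_comm
    _ = c i₀ := by
        rw [Matrix.nonsing_inv_mul _ hV]
        simp [Matrix.one_apply, ite_smul]

/-- **Landau–Kolmogorov interpolation at an endpoint (crude form, vector-valued).** For every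
`n ≥ 2` there is `C > 0` such that for every real normed space `W`, every `T > 0` and every curve
`φ : ℝ → W` that is `Cⁿ` at each point of `[0, T]`, with `‖φ‖ ≤ A` and `‖φ⁽ⁿ⁾‖ ≤ B` on `[0, T]`:
`‖φ'(0)‖ ≤ C (A / T + B T^{n−1})`. Landau 1913 (`n = 2`), Kolmogorov 1939; only the crude
endpoint form with a non-sharp constant is proved (Taylor's formula `taylor_mean_remainder_bound`
at the `n` nodes `T i/(n−1)`, `i = 0 … n−1`, and the inverse of the Vandermonde matrix of the
nodes, `Matrix.det_vandermonde_ne_zero_iff`; the constant is `1 + Σ_i |(V⁻¹) 1 i|`). This is stub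
`stub_landau` of the birth skeleton of crux `ClusterCompleteness.OmegaLimitMultiKerr`
(stmt-FinalStateConjecture-17639), verbatim. [folklore] -/
theorem stub_landau :
    ∀ n : ℕ, 2 ≤ n → ∃ C : ℝ, 0 < C ∧
      ∀ (W : Type) [NormedAddCommGroup W] [NormedSpace ℝ W] (φ : ℝ → W) (T A B : ℝ), 0 < T →
        (∀ t ∈ Set.Icc (0 : ℝ) T, ContDiffAt ℝ n φ t) →
        (∀ t ∈ Set.Icc (0 : ℝ) T, ‖φ t‖ ≤ A) →
        (∀ t ∈ Set.Icc (0 : ℝ) T, ‖iteratedDeriv n φ t‖ ≤ B) →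
        ‖deriv φ 0‖ ≤ C * (A / T + B * T ^ (n - 1)) := by
  intro n hn
  obtain ⟨m, rfl⟩ : ∃ m, n = m + 1 + 1 := ⟨n - 2, by omega⟩
  -- the `m + 2` equidistant nodes `i / (m + 1)` of `[0, 1]` and their Vandermonde matrix
  set a : Fin (m + 1 + 1) → ℝ := fun i ↦ (i : ℝ) / (m + 1) with ha
  have hm : (0 : ℝ) < m + 1 := by positivity
  have ha_inj : Function.Injective a := fun i j hij ↦ by
    simp only [ha] at hij
    rw [div_left_inj' hm.ne'] at hij
    exact Fin.ext (Nat.cast_injective hij)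
  have ha_mem : ∀ i, a i ∈ Icc (0 : ℝ) 1 := fun i ↦ by
    simp only [ha, Set.mem_Icc]
    refine ⟨by positivity, ?_⟩
    rw [div_le_one hm]
    have hi : (i : ℕ) ≤ m + 1 := Nat.lt_succ_iff.mp i.is_lt
    exact_mod_cast hi
  set V : Matrix (Fin (m + 1 + 1)) (Fin (m + 1 + 1)) ℝ := Matrix.vandermonde a with hV
  have hVdet : IsUnit V.det :=
    isUnit_iff_ne_zero.2 (Matrix.det_vandermonde_ne_zero_iff.2 ha_inj)
  set i₁ : Fin (m + 1 + 1) := ⟨1, by omega⟩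
  set K : ℝ := ∑ i, |V⁻¹ i₁ i| with hK
  have hK0 : 0 ≤ K := Finset.sum_nonneg fun i _ ↦ abs_nonneg _
  refine ⟨K + 1, add_pos_of_nonneg_of_pos hK0 one_pos, ?_⟩
  intro W _ _ φ T A B hT hφ hA hB
  have h0 : (0 : ℝ) ∈ Icc (0 : ℝ) T := left_mem_Icc.2 hT.le
  have hB0 : 0 ≤ B := (norm_nonneg _).trans (hB 0 h0)
  have hs : UniqueDiffOn ℝ (Icc (0 : ℝ) T) := uniqueDiffOn_Icc hT
  have hcont : ContDiffOn ℝ ((m + 1 : ℕ) + 1) φ (Icc 0 T) := fun t ht ↦ by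
    rw [← Nat.cast_add_one]
    exact (hφ t ht).contDiffWithinAt
  have ht_mem : ∀ i, T * a i ∈ Icc (0 : ℝ) T := fun i ↦
    ⟨mul_nonneg hT.le (ha_mem i).1, mul_le_of_le_one_right hT.le (ha_mem i).2⟩
  -- the Taylor polynomial of order `m + 1` at `0`, evaluated at the nodes `T * a i`
  set p : Fin (m + 1 + 1) → W := fun i ↦ taylorWithinEval φ (m + 1) (Icc 0 T) 0 (T * a i) with hp
  have hrem : ∀ i, ‖φ (T * a i) - p i‖ ≤ B * T ^ (m + 1 + 1) := fun i ↦ by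
    have h1 := taylor_mean_remainder_bound (f := φ) (C := B) (n := m + 1) hT.le hcont (ht_mem i)
      (fun y hy ↦ by rw [iteratedDerivWithin_eq_iteratedDeriv hs (hφ y hy) hy]; exact hB y hy)
    refine h1.trans ?_
    rw [sub_zero]
    calc B * (T * a i) ^ (m + 1 + 1) / ((Nat.factorial (m + 1) : ℕ) : ℝ)
        ≤ B * (T * a i) ^ (m + 1 + 1) :=
          div_le_self (mul_nonneg hB0 (pow_nonneg (ht_mem i).1 _))
            (Nat.one_le_cast.2 (Nat.one_le_iff_ne_zero.2 (Nat.factorial_ne_zero _)))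
      _ ≤ B * T ^ (m + 1 + 1) :=
          mul_le_mul_of_nonneg_left (pow_le_pow_left₀ (ht_mem i).1 (ht_mem i).2 _) hB0
  have hp_bound : ∀ i, ‖p i‖ ≤ A + B * T ^ (m + 1 + 1) := fun i ↦
    (norm_le_insert (φ (T * a i)) (p i)).trans (add_le_add (hA _ (ht_mem i)) (hrem i))
  -- the rescaled Taylor coefficients `c j = (T ^ j / j!) • φ^{(j)}(0)`
  set c : Fin (m + 1 + 1) → W := fun j ↦
    (((Nat.factorial (j : ℕ) : ℕ) : ℝ)⁻¹ * T ^ (j : ℕ)) • iteratedDerivWithin j φ (Icc 0 T) 0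
    with hc
  have hpc : ∀ i, p i = ∑ j, V i j • c j := fun i ↦ by
    simp only [hp, hc, hV, Matrix.vandermonde_apply]
    rw [taylor_within_apply, Finset.sum_range]
    refine Finset.sum_congr rfl fun j _ ↦ ?_
    rw [smul_smul, sub_zero, mul_pow]
    congr 1
    ring
  have hc1 : c i₁ = T • deriv φ 0 := by
    have hi₁ : (i₁ : ℕ) = 1 := rfl
    simp only [hc, hi₁]
    rw [Nat.factorial_one, Nat.cast_one, inv_one, one_mul, pow_one, iteratedDerivWithin_one,
      ((hφ 0 h0).differentiableAt (by exact_mod_cast Nat.succ_ne_zero (m + 1))).derivWithin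
        (hs 0 h0)]
  -- invert the Vandermonde system and estimate
  have hkey : T * ‖deriv φ 0‖ ≤ K * (A + B * T ^ (m + 1 + 1)) := by
    have hsolve : c i₁ = ∑ i, V⁻¹ i₁ i • p i := by
      rw [← landau_sum_inv_smul_sum_smul_eq V hVdet c i₁]
      simp only [hpc]
    calc T * ‖deriv φ 0‖ = ‖c i₁‖ := by
          rw [hc1, norm_smul, Real.norm_eq_abs, abs_of_pos hT]
      _ = ‖∑ i, V⁻¹ i₁ i • p i‖ := by rw [hsolve]
      _ ≤ ∑ i, ‖V⁻¹ i₁ i • p i‖ := norm_sum_le _ _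
      _ ≤ ∑ i, |V⁻¹ i₁ i| * (A + B * T ^ (m + 1 + 1)) :=
          Finset.sum_le_sum fun i _ ↦ by
            rw [norm_smul, Real.norm_eq_abs]
            exact mul_le_mul_of_nonneg_left (hp_bound i) (abs_nonneg _)
      _ = K * (A + B * T ^ (m + 1 + 1)) := by rw [hK, Finset.sum_mul]
  -- conclude
  rw [Nat.add_sub_cancel]
  have hX : 0 ≤ A / T + B * T ^ (m + 1) := by
    have hA0 : 0 ≤ A := (norm_nonneg _).trans (hA 0 h0)
    positivity
  calc ‖deriv φ 0‖ = T * ‖deriv φ 0‖ / T := by field_simp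
    _ ≤ K * (A + B * T ^ (m + 1 + 1)) / T := by gcongr
    _ = K * (A / T + B * T ^ (m + 1)) := by
        field_simp
        ring
    _ ≤ (K + 1) * (A / T + B * T ^ (m + 1)) := mul_le_mul_of_nonneg_right (by linarith) hX

end Summit.FinalStateConjecture.FinalStateConjecture.Theorems.ClusterCompleteness
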